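import Mathlib
import HarnessLib
import Summits.Ventures.LatticeQCDFlow.Exactness.LatticeCoordAvg

/-!
# The second moment of a log-weight with bounded oscillation: `∫e^{−2G} ≥ (∫e^{−G})²·(1 + e^{−4M}·Var G)`, its conditional form under coordinate averaging, a weighted Cauchy–Schwarz inequality, and the interaction-variance inequality `E[Var(h | ω_C)] ≥ Var(A_C h)`

HONEST FRAMING: exact (Metropolis-corrected) sampling algorithms for lattice gauge theory;
figures of merit are autocorrelation/cost numbers at stated couplings and volumes; no
continuum-physics claim.

Venture `LatticeQCDFlow` (cell pub-lqcd), topic `Exactness`; FANOUT row 7 (`s0-cpn-null`).  NEW WORK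
of the cell over the tree's `Exactness/LatticeCoordAvg.lean` (coordinate averages `A_s` on a finite
product of compact probability spaces: `E[A_s G] = E[G]`, `∫(h − ∫h)² = ∫h² − (∫h)²`, orthogonality
`E[(G − A_sG)Φ] = 0`, `A_s(Φ·H) = Φ·A_sH`) and Mathlib; nothing is cited as a fact.  The point: these are
the one-block inputs of a tensorized floor for the SECOND MOMENT of the importance weights of a flow
sampler — the quantity that controls its EFFECTIVE SAMPLE SIZE `(∫w)²/∫w²` (tree:
`Exactness/SphereLOFlowEffectiveAction.sq_integral_loWeight_ge` is the ceiling direction) — in the same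
way as `Exactness/CenteredExponentialMomentFloor` / `…VarianceFloor` were the one-block inputs of the
reverse-entropy floor of `Exactness/LatticeBlockEntropyFloor`: (i) for a continuous `G` with
oscillation `≤ M`, `∫e^{−2G} ≥ (∫e^{−G})²(1 + e^{−4M}Var G)` (the squared coefficient of variation of
`e^{−G}` is at least `e^{−4M}Var G`: `|e^{−y} − e^{−y₀}| ≥ e^{−M}|y − y₀|` on `[−M, M]`), and the same
conditionally on the un-averaged coordinates (`A_s` in place of `∫`); (ii) `(∫φ)² ≤ ∫φ²U · ∫U⁻¹` for
`U > 0`; (iii) `∫h² − ∫(A_s h)² ≥ ∫(A_{sᶜ}h)² − (∫h)²`, i.e. the mean conditional variance of `h`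
given the coordinates off `s` dominates the variance of its average over those coordinates
(`‖h − A_sh − A_{sᶜ}h + ∫h‖² ≥ 0`).

## Content

* §1 `exp_neg_sub_exp_neg_ge`, **`sq_integral_exp_neg_mul_le_integral_exp_neg_two_mul`** (one block),
  **`sq_coordAvg_exp_neg_mul_le`** (conditional form, pointwise in `ω`), `coordAvg_sq_sub_sq_coordAvg_le`
  (the conditional variance is `≤ M²`).
* §2 **`sq_integral_le_integral_sq_mul_mul_integral_inv`** (weighted Cauchy–Schwarz), `inv_one_add_le_one_sub_div`
  (`1/(1+v) ≤ 1 − v/(1+W)` for `0 ≤ v ≤ W`).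
* §3 `coordAvg_dependsOn_sdiff`, `coordAvg_sdiff_coordAvg` (`A_{sᶜ}(A_s h) = ∫h`), `integral_sq_sub_coordAvg`
  (`∫(h − A_s h)² = ∫h² − ∫(A_s h)²`), **`variance_coordAvg_sdiff_le_integral_sq_sub_coordAvg`** (THE
  INTERACTION-VARIANCE INEQUALITY `∫(A_{sᶜ} h − ∫h)² ≤ ∫h² − ∫(A_s h)²`).

NOT CLAIMED: anything about blocks, flows or numbers (see the sequel
`Exactness/LatticeBlockSecondMomentTensorization.lean`).
-/

noncomputable section

namespace Summit.Ventures.LatticeQCDFlow.Exactness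

open MeasureTheory Function
open scoped ENNReal

variable {ι : Type*} [Fintype ι] [DecidableEq ι]
variable {X : Type*} [MeasurableSpace X] [MetricSpace X] [CompactSpace X] [BorelSpace X]
  (μ : Measure X) [IsProbabilityMeasure μ]

/-! ## §1 The second-moment floor of one block -/

section OneBlock

omit [Fintype ι] [DecidableEq ι] in
/-- `e^{−u} − e^{−v} ≥ e^{−M}(v − u)` for `u ≤ v ≤ M`. -/
theorem exp_neg_sub_exp_neg_ge {u v M : ℝ} (huv : u ≤ v) (hv : v ≤ M) :
    Real.exp (-M) * (v - u) ≤ Real.exp (-u) - Real.exp (-v) := by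
  have h1 : Real.exp (-v) * (v - u) ≤ Real.exp (-u) - Real.exp (-v) := by
    have h := Real.add_one_le_exp (v - u)
    have e : Real.exp (-u) = Real.exp (-v) * Real.exp (v - u) := by rw [← Real.exp_add]; ring_nf
    rw [e]
    nlinarith [Real.exp_pos (-v)]
  exact le_trans (mul_le_mul_of_nonneg_right (Real.exp_le_exp.2 (by linarith)) (by linarith)) h1

omit [DecidableEq ι] in
/-- **THE SECOND-MOMENT FLOOR OF ONE BLOCK.**  For a continuous `G` on the product with oscillation
`|G ω − G ω'| ≤ M`: `(∫e^{−G} dπ)²·(1 + e^{−4M}·∫(G − ∫G)² dπ) ≤ ∫e^{−2G} dπ`. -/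
theorem sq_integral_exp_neg_mul_le_integral_exp_neg_two_mul {G : (ι → X) → ℝ} (hG : Continuous G)
    {M : ℝ} (hM : ∀ ω ω', |G ω - G ω'| ≤ M) :
    (∫ ω, Real.exp (-G ω) ∂Measure.pi (fun _ : ι => μ)) ^ 2 *
        (1 + Real.exp (-4 * M) * ∫ ω, (G ω - ∫ ω', G ω' ∂Measure.pi (fun _ : ι => μ)) ^ 2
          ∂Measure.pi (fun _ : ι => μ)) ≤
      ∫ ω, Real.exp (-2 * G ω) ∂Measure.pi (fun _ : ι => μ) := by
  set π : Measure (ι → X) := Measure.pi (fun _ : ι => μ) with hπ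
  set m : ℝ := ∫ ω', G ω' ∂π with hm
  -- `|G − m| ≤ M`
  have hGm : ∀ ω, |G ω - m| ≤ M := by
    intro ω
    have e : G ω - m = ∫ ω', (G ω - G ω') ∂π := by
      rw [integral_sub (integrable_const _) (integrable_pi_of_continuous μ hG), integral_const, smul_eq_mul,
        probReal_univ, one_mul]
    rw [e]
    refine (abs_integral_le_integral_abs).trans ?_
    calc ∫ ω', |G ω - G ω'| ∂π ≤ ∫ _, M ∂π := integral_mono_of_nonneg (ae_of_all _ fun _ => abs_nonneg _)
          (integrable_const M) (ae_of_all _ fun ω' => hM ω ω')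
      _ = M := by rw [integral_const, smul_eq_mul, probReal_univ, one_mul]
  -- the centred exponential moments
  have hcY : Continuous fun ω => Real.exp (-(G ω - m)) := (hG.sub continuous_const).neg.rexp
  have hIY : Integrable (fun ω => Real.exp (-(G ω - m))) π := integrable_pi_of_continuous μ hcY
  set a : ℝ := ∫ ω, Real.exp (-(G ω - m)) ∂π with ha
  have ha_bounds : Real.exp (-M) ≤ a ∧ a ≤ Real.exp M := by
    constructor
    · have h : ∫ _, Real.exp (-M) ∂π ≤ a := integral_mono (integrable_const _) hIY fun ω =>
        Real.exp_le_exp.2 (by linarith [(abs_le.1 (hGm ω)).2])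
      rwa [integral_const, smul_eq_mul, probReal_univ, one_mul] at h
    · have h : a ≤ ∫ _, Real.exp M ∂π := integral_mono hIY (integrable_const _) fun ω =>
        Real.exp_le_exp.2 (by linarith [(abs_le.1 (hGm ω)).1])
      rwa [integral_const, smul_eq_mul, probReal_univ, one_mul] at h
  have ha_pos : 0 < a := lt_of_lt_of_le (Real.exp_pos _) ha_bounds.1
  set y₀ : ℝ := -Real.log a with hy₀
  have hey₀ : Real.exp (-y₀) = a := by rw [hy₀, neg_neg, Real.exp_log ha_pos]
  have hy₀M : |y₀| ≤ M := by
    rw [abs_le, hy₀]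
    constructor
    · have := Real.log_le_log ha_pos ha_bounds.2
      rw [Real.log_exp] at this; linarith
    · have := Real.log_le_log (Real.exp_pos _) ha_bounds.1
      rw [Real.log_exp] at this; linarith
  -- pointwise: `(e^{−Y} − e^{−y₀})² ≥ e^{−2M}(Y − y₀)²`
  have hpt : ∀ ω, Real.exp (-2 * M) * (G ω - m - y₀) ^ 2 ≤
      (Real.exp (-(G ω - m)) - Real.exp (-y₀)) ^ 2 := by
    intro ω
    have hYM := abs_le.1 (hGm ω)
    have hy := abs_le.1 hy₀M
    have e2 : Real.exp (-2 * M) = Real.exp (-M) ^ 2 := by rw [← Real.exp_nat_mul]; ring_nf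
    rw [e2, ← mul_pow]
    rcases le_total (G ω - m) y₀ with h | h
    · have k := exp_neg_sub_exp_neg_ge h hy.2
      have k0 : 0 ≤ Real.exp (-M) * (y₀ - (G ω - m)) := mul_nonneg (Real.exp_pos _).le (by linarith)
      calc (Real.exp (-M) * (G ω - m - y₀)) ^ 2 = (Real.exp (-M) * (y₀ - (G ω - m))) ^ 2 := by ring
        _ ≤ (Real.exp (-(G ω - m)) - Real.exp (-y₀)) ^ 2 := pow_le_pow_left₀ k0 k 2
    · have k := exp_neg_sub_exp_neg_ge h hYM.2
      have k0 : 0 ≤ Real.exp (-M) * (G ω - m - y₀) := mul_nonneg (Real.exp_pos _).le (by linarith)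
      calc (Real.exp (-M) * (G ω - m - y₀)) ^ 2
          ≤ (Real.exp (-y₀) - Real.exp (-(G ω - m))) ^ 2 := pow_le_pow_left₀ k0 k 2
        _ = (Real.exp (-(G ω - m)) - Real.exp (-y₀)) ^ 2 := by ring
  -- integrate: `∫e^{−2Y} − a² ≥ e^{−2M}·Var`
  have hcV : Continuous fun ω => (G ω - m - y₀) ^ 2 := ((hG.sub continuous_const).sub continuous_const).pow 2
  have hc2 : Continuous fun ω => Real.exp (-2 * (G ω - m)) := (continuous_const.mul (hG.sub continuous_const)).rexp
  have hI2 : Integrable (fun ω => Real.exp (-2 * (G ω - m))) π := integrable_pi_of_continuous μ hc2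
  have hIl : Integrable (fun ω => Real.exp (-2 * M) * (G ω - m - y₀) ^ 2) π :=
    integrable_pi_of_continuous μ (continuous_const.mul hcV)
  have hIr : Integrable (fun ω => (Real.exp (-(G ω - m)) - Real.exp (-y₀)) ^ 2) π :=
    integrable_pi_of_continuous μ ((hcY.sub continuous_const).pow 2)
  have hint : ∫ ω, Real.exp (-2 * M) * (G ω - m - y₀) ^ 2 ∂π ≤
      ∫ ω, (Real.exp (-(G ω - m)) - Real.exp (-y₀)) ^ 2 ∂π := integral_mono hIl hIr hpt
  have eR : ∫ ω, (Real.exp (-(G ω - m)) - Real.exp (-y₀)) ^ 2 ∂π = ∫ ω, Real.exp (-2 * (G ω - m)) ∂π - a ^ 2 := by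
    have e : ∀ ω, (Real.exp (-(G ω - m)) - Real.exp (-y₀)) ^ 2 =
        Real.exp (-2 * (G ω - m)) - 2 * a * Real.exp (-(G ω - m)) + a ^ 2 := by
      intro ω; rw [hey₀, sub_sq, ← Real.exp_nat_mul]; ring_nf
    simp_rw [e]
    have hIa : Integrable (fun ω => 2 * a * Real.exp (-(G ω - m))) π := hIY.const_mul _
    have hI12 : Integrable (fun ω => Real.exp (-2 * (G ω - m)) - 2 * a * Real.exp (-(G ω - m))) π := hI2.sub hIa
    rw [integral_add hI12 (integrable_const _), integral_sub hI2 hIa,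
      integral_const_mul, integral_const, smul_eq_mul, probReal_univ, one_mul, ← ha]
    ring
  rw [integral_const_mul, eR] at hint
  have hvar : ∫ ω, (G ω - m) ^ 2 ∂π ≤ ∫ ω, (G ω - m - y₀) ^ 2 ∂π := by
    have hc1 : Continuous fun ω => G ω - m := hG.sub continuous_const
    have hI1 : Integrable (fun ω => G ω - m) π := integrable_pi_of_continuous μ hc1
    have hIsq : Integrable (fun ω => (G ω - m) ^ 2) π := integrable_pi_of_continuous μ (hc1.pow 2)
    have h0 : ∫ ω, (G ω - m) ∂π = 0 := by
      rw [integral_sub (integrable_pi_of_continuous μ hG) (integrable_const _), integral_const, smul_eq_mul,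
        probReal_univ, one_mul, hm, sub_self]
    have e : ∀ ω, (G ω - m - y₀) ^ 2 = (G ω - m) ^ 2 - 2 * y₀ * (G ω - m) + y₀ ^ 2 := fun ω => by ring
    simp_rw [e]
    have hIb : Integrable (fun ω => 2 * y₀ * (G ω - m)) π := hI1.const_mul _
    have hI12 : Integrable (fun ω => (G ω - m) ^ 2 - 2 * y₀ * (G ω - m)) π := hIsq.sub hIb
    rw [integral_add hI12 (integrable_const _), integral_sub hIsq hIb,
      integral_const_mul, h0, integral_const, smul_eq_mul, probReal_univ, one_mul]
    nlinarith [sq_nonneg y₀]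
  -- un-centre: `∫e^{−G} = e^{−m}a`, `∫e^{−2G} = e^{−2m}∫e^{−2Y}`
  have e1 : ∫ ω, Real.exp (-G ω) ∂π = Real.exp (-m) * a := by
    rw [ha, ← integral_const_mul]
    refine integral_congr_ae (ae_of_all _ fun ω => ?_)
    show Real.exp (-G ω) = Real.exp (-m) * Real.exp (-(G ω - m))
    rw [← Real.exp_add]; ring_nf
  have e2 : ∫ ω, Real.exp (-2 * G ω) ∂π = Real.exp (-2 * m) * ∫ ω, Real.exp (-2 * (G ω - m)) ∂π := by
    rw [← integral_const_mul]
    refine integral_congr_ae (ae_of_all _ fun ω => ?_)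
    show Real.exp (-2 * G ω) = Real.exp (-2 * m) * Real.exp (-2 * (G ω - m))
    rw [← Real.exp_add]; ring_nf
  rw [e1, e2]
  have hvar0 : 0 ≤ ∫ ω, (G ω - m) ^ 2 ∂π := integral_nonneg fun ω => sq_nonneg _
  have ha2 : a ^ 2 ≤ Real.exp M ^ 2 := pow_le_pow_left₀ ha_pos.le ha_bounds.2 2
  have key : a ^ 2 * (Real.exp (-4 * M) * ∫ ω, (G ω - m) ^ 2 ∂π) ≤
      Real.exp (-2 * M) * ∫ ω, (G ω - m) ^ 2 ∂π := by
    have e : Real.exp (-2 * M) = Real.exp M ^ 2 * Real.exp (-4 * M) := by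
      rw [← Real.exp_nat_mul, ← Real.exp_add]; ring_nf
    calc a ^ 2 * (Real.exp (-4 * M) * ∫ ω, (G ω - m) ^ 2 ∂π)
        = a ^ 2 * Real.exp (-4 * M) * ∫ ω, (G ω - m) ^ 2 ∂π := by ring
      _ ≤ Real.exp M ^ 2 * Real.exp (-4 * M) * ∫ ω, (G ω - m) ^ 2 ∂π :=
          mul_le_mul_of_nonneg_right (mul_le_mul_of_nonneg_right ha2 (Real.exp_pos _).le) hvar0
      _ = Real.exp (-2 * M) * ∫ ω, (G ω - m) ^ 2 ∂π := by rw [e]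
  have hem : 0 < Real.exp (-2 * m) := Real.exp_pos _
  have e3 : (Real.exp (-m) * a) ^ 2 = Real.exp (-2 * m) * a ^ 2 := by
    rw [mul_pow, ← Real.exp_nat_mul]; ring_nf
  rw [e3]
  nlinarith [mul_le_mul_of_nonneg_left (le_trans key (le_trans (mul_le_mul_of_nonneg_left hvar
    (Real.exp_pos _).le) hint)) hem.le]

/-- **THE CONDITIONAL FORM**: for the coordinate average `A_s` (integrating out the `s`-coordinates,
keeping the others) and a continuous `h` with oscillation `≤ M`, pointwise in the kept coordinates:
`(A_s e^{−h})²·(1 + e^{−4M}(A_s(h²) − (A_s h)²)) ≤ A_s(e^{−2h})`. -/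
theorem sq_coordAvg_exp_neg_mul_le (s : Finset ι) {h : (ι → X) → ℝ} (hh : Continuous h) {M : ℝ}
    (hM : ∀ ω ω', |h ω - h ω'| ≤ M) (ω : ι → X) :
    (coordAvg μ s (fun ω => Real.exp (-h ω)) ω) ^ 2 *
        (1 + Real.exp (-4 * M) * (coordAvg μ s (fun ω => h ω ^ 2) ω - (coordAvg μ s h ω) ^ 2)) ≤
      coordAvg μ s (fun ω => Real.exp (-2 * h ω)) ω := by
  have hc : Continuous fun ω' : ι → X => h (s.piecewise ω' ω) :=
    hh.comp ((continuous_piecewise_prod s).comp (Continuous.prodMk_right ω))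
  have h1 := sq_integral_exp_neg_mul_le_integral_exp_neg_two_mul μ hc (M := M) fun ω₁ ω₂ => hM _ _
  rw [integral_sq_sub_mean μ hc] at h1
  exact h1

/-- **The conditional variance is at most `M²`** when the oscillation is `≤ M`:
`A_s(h²) − (A_s h)² ≤ M²` pointwise. -/
theorem coordAvg_sq_sub_sq_coordAvg_le (s : Finset ι) {h : (ι → X) → ℝ} (hh : Continuous h) {M : ℝ}
    (hM : ∀ ω ω', |h ω - h ω'| ≤ M) (ω : ι → X) :
    coordAvg μ s (fun ω => h ω ^ 2) ω - (coordAvg μ s h ω) ^ 2 ≤ M ^ 2 := by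
  set π : Measure (ι → X) := Measure.pi (fun _ : ι => μ) with hπ
  have hc : Continuous fun ω' : ι → X => h (s.piecewise ω' ω) :=
    hh.comp ((continuous_piecewise_prod s).comp (Continuous.prodMk_right ω))
  have hv := integral_sq_sub_mean μ hc
  have hbound : ∀ ω', (h (s.piecewise ω' ω) - ∫ ω'', h (s.piecewise ω'' ω) ∂π) ^ 2 ≤ M ^ 2 := by
    intro ω'
    have hdev : |h (s.piecewise ω' ω) - ∫ ω'', h (s.piecewise ω'' ω) ∂π| ≤ M := by
      have e : h (s.piecewise ω' ω) - ∫ ω'', h (s.piecewise ω'' ω) ∂π =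
          ∫ ω'', (h (s.piecewise ω' ω) - h (s.piecewise ω'' ω)) ∂π := by
        rw [integral_sub (integrable_const _) (integrable_pi_of_continuous μ hc), integral_const, smul_eq_mul,
          probReal_univ, one_mul]
      rw [e]
      refine (abs_integral_le_integral_abs).trans ?_
      calc ∫ ω'', |h (s.piecewise ω' ω) - h (s.piecewise ω'' ω)| ∂π ≤ ∫ _, M ∂π :=
            integral_mono_of_nonneg (ae_of_all _ fun _ => abs_nonneg _) (integrable_const M)
              (ae_of_all _ fun ω'' => hM _ _)
        _ = M := by rw [integral_const, smul_eq_mul, probReal_univ, one_mul]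
    have h2 := sq_le_sq' (abs_le.1 hdev).1 (abs_le.1 hdev).2
    simpa using h2
  have hle : ∫ ω', (h (s.piecewise ω' ω) - ∫ ω'', h (s.piecewise ω'' ω) ∂π) ^ 2 ∂π ≤ M ^ 2 := by
    have h := integral_mono (integrable_pi_of_continuous μ ((hc.sub continuous_const).pow 2))
      (integrable_const (M ^ 2)) hbound
    rwa [integral_const, smul_eq_mul, probReal_univ, one_mul] at h
  rw [hv] at hle
  exact hle

end OneBlock

/-! ## §2 A weighted Cauchy–Schwarz inequality; `1/(1+v) ≤ 1 − v/(1+W)` -/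

section CauchySchwarz

omit [DecidableEq ι] in
/-- **Weighted Cauchy–Schwarz**: `(∫φ)² ≤ ∫φ²U · ∫U⁻¹` for continuous `φ` and continuous `U > 0`
(the quadratic `t ↦ ∫U⁻¹(t − φU)² ≥ 0` has nonpositive discriminant). -/
theorem sq_integral_le_integral_sq_mul_mul_integral_inv {φ U : (ι → X) → ℝ} (hφ : Continuous φ)
    (hU : Continuous U) (hUpos : ∀ ω, 0 < U ω) :
    (∫ ω, φ ω ∂Measure.pi (fun _ : ι => μ)) ^ 2 ≤
      (∫ ω, φ ω ^ 2 * U ω ∂Measure.pi (fun _ : ι => μ)) * ∫ ω, (U ω)⁻¹ ∂Measure.pi (fun _ : ι => μ) := by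
  set π : Measure (ι → X) := Measure.pi (fun _ : ι => μ) with hπ
  have hUinv : Continuous fun ω => (U ω)⁻¹ := hU.inv₀ fun ω => (hUpos ω).ne'
  have hIinv : Integrable (fun ω => (U ω)⁻¹) π := integrable_pi_of_continuous μ hUinv
  have hIφ : Integrable φ π := integrable_pi_of_continuous μ hφ
  have hIA : Integrable (fun ω => φ ω ^ 2 * U ω) π := integrable_pi_of_continuous μ ((hφ.pow 2).mul hU)
  have hq : ∀ t : ℝ, 0 ≤ (∫ ω, (U ω)⁻¹ ∂π) * (t * t) + (-2 * ∫ ω, φ ω ∂π) * t +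
      ∫ ω, φ ω ^ 2 * U ω ∂π := by
    intro t
    have h0 : 0 ≤ ∫ ω, (U ω)⁻¹ * (t - φ ω * U ω) ^ 2 ∂π :=
      integral_nonneg fun ω => mul_nonneg (inv_pos.2 (hUpos ω)).le (sq_nonneg _)
    have e : ∀ ω, (U ω)⁻¹ * (t - φ ω * U ω) ^ 2 = t ^ 2 * (U ω)⁻¹ - 2 * t * φ ω + φ ω ^ 2 * U ω := by
      intro ω
      have hU0 : U ω ≠ 0 := (hUpos ω).ne'
      field_simp
      ring
    simp_rw [e] at h0
    have hI1 : Integrable (fun ω => t ^ 2 * (U ω)⁻¹) π := hIinv.const_mul _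
    have hI2 : Integrable (fun ω => 2 * t * φ ω) π := hIφ.const_mul _
    have hI12 : Integrable (fun ω => t ^ 2 * (U ω)⁻¹ - 2 * t * φ ω) π := hI1.sub hI2
    rw [integral_add hI12 hIA, integral_sub hI1 hI2, integral_const_mul, integral_const_mul] at h0
    nlinarith [h0]
  have hd := discrim_le_zero hq
  rw [discrim] at hd
  nlinarith [hd]

/-- `1/(1 + v) ≤ 1 − v/(1 + W)` for `0 ≤ v ≤ W`. -/
theorem inv_one_add_le_one_sub_div {v W : ℝ} (hv : 0 ≤ v) (hvW : v ≤ W) : (1 + v)⁻¹ ≤ 1 - v / (1 + W) := by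
  have h1 : 0 < 1 + v := by linarith
  have h2 : 0 < 1 + W := by linarith
  rw [inv_eq_one_div, div_le_iff₀ h1]
  have e : (1 - v / (1 + W)) * (1 + v) = 1 + v * (W - v) / (1 + W) := by
    field_simp
    ring
  rw [e]
  have : 0 ≤ v * (W - v) / (1 + W) := div_nonneg (mul_nonneg hv (sub_nonneg.2 hvW)) h2.le
  linarith

end CauchySchwarz

/-! ## §3 The interaction-variance inequality -/

section Interaction

omit [MetricSpace X] [CompactSpace X] [BorelSpace X] [IsProbabilityMeasure μ] in
/-- `A_s G` does not depend on the coordinates in `s`: it is a function of the others. -/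
theorem coordAvg_dependsOn_sdiff (s : Finset ι) (G : (ι → X) → ℝ) :
    DependsOn (coordAvg μ s G) ↑(Finset.univ \ s) := by
  intro ω₁ ω₂ h
  have e : s.piecewise ω₁ ω₂ = ω₁ := by
    ext i
    by_cases hi : i ∈ s
    · rw [Finset.piecewise_eq_of_mem _ _ _ hi]
    · rw [Finset.piecewise_eq_of_notMem _ _ _ hi]
      exact (h i (by simp [hi])).symm
  rw [← e, coordAvg_apply_piecewise]

/-- **`A_{sᶜ}(A_s h) = ∫h`**: averaging the kept coordinates of `A_s h` gives the mean. -/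
theorem coordAvg_sdiff_coordAvg (s : Finset ι) {h : (ι → X) → ℝ} (hh : Continuous h) (ω : ι → X) :
    coordAvg μ (Finset.univ \ s) (coordAvg μ s h) ω = ∫ ω', h ω' ∂Measure.pi (fun _ : ι => μ) := by
  rw [← integral_coordAvg μ s hh]
  unfold coordAvg
  refine integral_congr_ae (ae_of_all _ fun ω' => ?_)
  have hdep := coordAvg_dependsOn_sdiff μ s h
  exact hdep fun i hi => Finset.piecewise_eq_of_mem _ _ _ hi

omit [DecidableEq ι] in
/-- **Pythagoras for `A_s`**: `∫(h − A_s h)² = ∫h² − ∫(A_s h)²` — the mean conditional variance of `h`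
given the coordinates off `s`. -/
theorem integral_sq_sub_coordAvg [DecidableEq ι] (s : Finset ι) {h : (ι → X) → ℝ} (hh : Continuous h) :
    ∫ ω, (h ω - coordAvg μ s h ω) ^ 2 ∂Measure.pi (fun _ : ι => μ) =
      ∫ ω, h ω ^ 2 ∂Measure.pi (fun _ : ι => μ) - ∫ ω, (coordAvg μ s h ω) ^ 2 ∂Measure.pi (fun _ : ι => μ) := by
  set π : Measure (ι → X) := Measure.pi (fun _ : ι => μ) with hπ
  have hA : Continuous (coordAvg μ s h) := continuous_coordAvg μ s hh
  have horth : ∫ ω, (h ω - coordAvg μ s h ω) * coordAvg μ s h ω ∂π = 0 :=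
    integral_sub_coordAvg_mul_eq_zero μ s hh hA fun ω ω' => coordAvg_apply_piecewise μ s h ω ω'
  have e : ∀ ω, (h ω - coordAvg μ s h ω) ^ 2 =
      (h ω ^ 2 - (coordAvg μ s h ω) ^ 2) - 2 * ((h ω - coordAvg μ s h ω) * coordAvg μ s h ω) := by
    intro ω; ring
  simp_rw [e]
  have hI1 : Integrable (fun ω => h ω ^ 2) π := integrable_pi_of_continuous μ (hh.pow 2)
  have hI2 : Integrable (fun ω => (coordAvg μ s h ω) ^ 2) π := integrable_pi_of_continuous μ (hA.pow 2)
  have hI3 : Integrable (fun ω => (h ω - coordAvg μ s h ω) * coordAvg μ s h ω) π :=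
    integrable_pi_of_continuous μ ((hh.sub hA).mul hA)
  have hI12 : Integrable (fun ω => h ω ^ 2 - (coordAvg μ s h ω) ^ 2) π := hI1.sub hI2
  rw [integral_sub hI12 (hI3.const_mul _), integral_sub hI1 hI2, integral_const_mul, horth, mul_zero, sub_zero]

/-- **THE INTERACTION-VARIANCE INEQUALITY**: `∫(A_{sᶜ} h)² − (∫h)² ≤ ∫h² − ∫(A_s h)²` — the variance of
the average of `h` over the coordinates off `s` is at most the mean conditional variance of `h` given
those coordinates (`A_{sᶜ}h − ∫h = A_{sᶜ}(h − A_s h)` and Jensen for `A_{sᶜ}`). -/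
theorem variance_coordAvg_sdiff_le_integral_sq_sub_coordAvg (s : Finset ι) {h : (ι → X) → ℝ}
    (hh : Continuous h) :
    ∫ ω, (coordAvg μ (Finset.univ \ s) h ω - ∫ ω', h ω' ∂Measure.pi (fun _ : ι => μ)) ^ 2
        ∂Measure.pi (fun _ : ι => μ) ≤
      ∫ ω, h ω ^ 2 ∂Measure.pi (fun _ : ι => μ) - ∫ ω, (coordAvg μ s h ω) ^ 2 ∂Measure.pi (fun _ : ι => μ) := by
  set π : Measure (ι → X) := Measure.pi (fun _ : ι => μ) with hπ
  have hA : Continuous (coordAvg μ s h) := continuous_coordAvg μ s hh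
  have hf : Continuous fun ω => h ω - coordAvg μ s h ω := hh.sub hA
  have hf2 : Continuous fun ω => (h ω - coordAvg μ s h ω) ^ 2 := hf.pow 2
  -- `A_{sᶜ}h − ∫h = A_{sᶜ}(h − A_s h)`
  have hpt : ∀ ω, coordAvg μ (Finset.univ \ s) h ω - ∫ ω', h ω' ∂π =
      coordAvg μ (Finset.univ \ s) (fun ω => h ω - coordAvg μ s h ω) ω := by
    intro ω
    rw [coordAvg_sub μ _ hh hA, coordAvg_sdiff_coordAvg μ s hh]
  simp_rw [hpt]
  -- Jensen `(A f)² ≤ A(f²)` and `∫A(f²) = ∫f²`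
  have hJ : ∫ ω, (coordAvg μ (Finset.univ \ s) (fun ω => h ω - coordAvg μ s h ω) ω) ^ 2 ∂π ≤
      ∫ ω, coordAvg μ (Finset.univ \ s) (fun ω => (h ω - coordAvg μ s h ω) ^ 2) ω ∂π :=
    integral_mono (integrable_pi_of_continuous μ ((continuous_coordAvg μ _ hf).pow 2))
      (integrable_pi_of_continuous μ (continuous_coordAvg μ _ hf2))
      fun ω => sq_coordAvg_le μ _ hf ω
  refine hJ.trans (le_of_eq ?_)
  rw [integral_coordAvg μ _ hf2]
  exact integral_sq_sub_coordAvg μ s hh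

end Interaction

end Summit.Ventures.LatticeQCDFlow.Exactness

end
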